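import Literature.NumberTheory.EllipticCurves.IwasawaSelmerControlExactCountProofs
import Literature.NumberTheory.EllipticCurves.IwasawaSelmerControlLocalizationProofs
import Literature.NumberTheory.EllipticCurves.SelmerLayerRestrictionInjectiveProofs
import HarnessLib

/-!
# Route `AlignedTransportAtTwo`, crux C2 `MainConjectureOfRankZeroBSDAtTwo` (stmt-BirchSwinnertonDyer-22298):
# THE RELAXED GROUP INSIDE GREENBERG'S PREIMAGE — for EVERY `ℤ_p`-extension and all layers `n ≤ m`,
# `Sel_{p^∞}(E/K_n) ≤ Sel♯⁽ᵐ⁾_n := res⁻¹_{K_n→K_m}(Sel_{p^∞}(E/K_m)) ≤ A_n := h_n⁻¹(Sel_{p^∞}(E/K_∞))`, so the LAYER-RELAXATION DEFECT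
# `[Sel♯⁽ᵐ⁾_n : Sel_n]` DIVIDES Greenberg's `#ker g_n = #(A_n/Sel_n)`; LOCAL FORM: the relaxed condition at a place is membership of the
# localisation in the local inflation–restriction kernel `ker(H¹(K_{n,w}, E) → H¹(K_{m,w'}, E)) ⊆ 𝒦_{v,n}` — trivial at the archimedean
# places and at every finite place of `K_n` that splits completely in `K_m`: THE DEFECT LIVES AT THE NON-SPLIT FINITE PLACES

HONEST FRAMING (cell `bsd-f1-sign2`, WIDTH-5 attached prover seat `bsd-line-att-p5` gen 59 on line `birth` of the lead `bsd-line-att-p2`;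
`--supports` stmt-BirchSwinnertonDyer-22298, closes nothing; BSD is NOT proved by any of this; the crux C2, its verdict «blocked-on
`Rank1Residual.GreenbergMuConjectureIrreducible`» and every registered stub (P / T / Kμ / LimDoor / MuIneqʳ / PFμ⁺) are untouched). THEOREMS ONLY — no `def`,
no instance, no named fact, no `sorry`. Route-independent (any number field `K`, any prime `p`, any `ℤ_p`-extension `κ`, every pair of layers
`n ≤ m`); NO hypothesis anywhere in this file. Lineage glue on gen 58's successor (1) («the relaxed group in closed form»): gen 58
(`…GrowthFiniteTwistPlusMinus`) proved that on the seed cell the minus part `M_{n+1} = ker(N_{K_{n+1}/K_n} | Sel_{2^∞}(E/K_{n+1}))` has EXACTLY the order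
of the `K_{n+1}`-relaxed group `Sel♯_n(E′) = res⁻¹(Sel_{2^∞}(E′/K_{n+1}))` of the twist one layer down, and left the door
`0 < #Sel♯_n(E′)·#ker g_{n+1} < 2^{2ⁿ} ⟹ μ = 0`. This file controls the relaxation `Sel♯ ⊇ Sel` by the tree's rendering of Greenberg's control kernel.

THE POINT. (§1) Restriction is transitive (`res_{m→∞} ∘ res_{n→m} = h_n`, tree `resOfLe_comp`) and carries Selmer groups to Selmer groups
(tree `resOfLe_mem_selmerLayer`, `map_layerToInfty_selmerLayer_le`), so the relaxed groups form an increasing filtration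
**`Sel_n ≤ Sel♯⁽ᵐ⁾_n ≤ Sel♯⁽ᵐ′⁾_n ≤ A_n = h_n⁻¹(Sel_∞)`** (`n ≤ m ≤ m′`), and `A_n/Sel_n` IS Greenberg's `ker g_n` in the tree's currency
(`WeierstrassCurve.KerG κ n`, file `IwasawaSelmerControlExactCountProofs`). Hence, as `Nat.card`s with no finiteness assumed:
★★★ **`[Sel♯⁽ᵐ⁾_n : Sel_n] ∣ #ker g_n`**, **`#Sel_n ∣ #Sel♯⁽ᵐ⁾_n ∣ #Sel_n · #ker g_n`**, `#A_n = #ker g_n · #Sel_n`, and the two-sided form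
★★ **`#ker g_n = [Sel♯⁽ᵐ⁾_n : Sel_n] · [A_n : Sel♯⁽ᵐ⁾_n]` with `[A_n : Sel♯⁽ᵐ⁾_n] ∣ #ker g_m`** (the relaxation defect is the part of `ker g_n`
that dies in `ker g_m` under `A_n → A_m`, `A_n = res⁻¹_{n→m}(A_m)`). (§2) LOCAL FORM: localisation commutes with restriction
(tree `localResOverOfEmb_resOfLe`) and conjugation commutes with restriction (`resOfLe_comp_conjH1`), so **`c ∈ Sel♯⁽ᵐ⁾_n` iff at every pair
(place `v` of `K`, `σ ∈ Γ_K`) the localisation of `conj_σ c` lies in the LOCAL inflation–restriction kernel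
`ker(H¹(Gal(K̄_v/K_vK_n), E(K̄_v)) → H¹(Gal(K̄_v/K_vK_m), E(K̄_v)))`** (`mem_comap_resOfLe_selmerLayer_iff`), a subgroup of Greenberg's local tower kernel
`𝒦_{v,n}` (`ker_resOfLe_local_le_localTowerKer`); this local kernel VANISHES at every archimedean place (they split completely in `K_∞/K`, tree
`ZpExtension.resGal_infinitePlace_mem_kerSubgroup`) and at every finite `v` whose chosen place of `K_n` splits completely in `K_m`
(`Gal(K̄_v/K_vK_n) = Gal(K̄_v/K_vK_m)`; restriction along equal subgroups is injective, tree `resOfLe_injective_of_ge`). So ★★★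
**a relaxed class satisfying the HONEST local conditions at the non-split finite places is an honest Selmer class** (`mem_selmerLayer_of_mem_comap`):
the relaxation defect is carried by the finitely many places of `K_n` that do not split in `K_m` — at the `E[2]`-level and for ONE quadratic layer
this is Kramer's `i_v = dim E(F_v)/N E(K_w) = dim i_v⁻¹(S′_v)/S_v` (Kramer 1981, eq. (11), Prop. 7), whose local values are his Props. 1–6.
What is NOT claimed: no local index is COMPUTED (the values `c_v^{(p)}`, `#Ẽ(f_v)[p]²` are Greenberg's Lemmas 3.3–3.4, named facts elsewhere in the tree);
nothing numerical about any curve; C2 untouched. Memo `Cruxes/MainConjectureOfRankZeroBSDAtTwo/RELAXED-PREIMAGE-att-p5-g59.md`.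

References: R. Greenberg, *Iwasawa theory for elliptic curves*, LNM 1716 (1999), §3 pp. 85–90 (the groups `G_E(F_n)`, the maps `s_n, h_n, g_n`, Lemmas 3.1–3.5,
`r_{v_n}`), §4 Lemma 4.3 p. 103 [GreenbergLNM1716]; J.-P. Serre, *Galois Cohomology*, I.§2.4–2.6 [SerreGaloisCohomology1997]; J. Neukirch, A. Schmidt,
K. Wingberg, *Cohomology of Number Fields*, I.§5–§6 [NeukirchSchmidtWingberg2008]; K. Kramer, *Arithmetic of elliptic curves upon quadratic extension*,
Trans. AMS 264 (1981), §2 Props. 1–7, eq. (11) [Kramer1981]; B. Mazur, Invent. Math. 18 (1972) §6 [Mazur1972]; L. Washington, GTM 83, §13.1 [Washington1997].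
-/

set_option linter.dupNamespace false
set_option autoImplicit false

noncomputable section

open scoped Classical

universe u

namespace Summit.BirchSwinnertonDyer.BirchSwinnertonDyer.Theorems.AlignedTransportAtTwoHalfDescentLayerIndexGrowthFiniteTwistRelaxed

open WeierstrassCurve Literature.NumberTheory.EllipticCurves NumberField IsDedekindDomain

/-! ## §0 Two abelian-group counts -/

section Abstract

variable {X : Type*} [AddCommGroup X]

/-- `#K = #H · [K : H]` for `H ≤ K` (Lagrange inside `K`; `Nat.card`, no finiteness). [folklore] -/
theorem natCard_eq_natCard_mul_relIndex {H K : AddSubgroup X} (h : H ≤ K) : Nat.card K = Nat.card H * H.relIndex K := by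
  rw [AddSubgroup.relIndex, ← Nat.card_congr (AddSubgroup.addSubgroupOfEquivOfLe h).toEquiv]
  exact (AddSubgroup.card_mul_index _).symm

/-- `[K : f⁻¹(S) ∩ K] ∣ #(Y/S)`-type count: for `f : X →+ Y`, `S ≤ Y` and `K ≤ X` with `f(K) ≤ T`, the index of `f⁻¹(S) ⊓ K`… stated in the form used below:
**the index in `K` of the kernel of a homomorphism `K → Q` divides `#Q`**. [folklore] -/
theorem index_ker_dvd_natCard {K : AddSubgroup X} {Q : Type*} [AddCommGroup Q] (φ : K →+ Q) : φ.ker.index ∣ Nat.card Q := by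
  rw [AddSubgroup.index_ker]
  exact AddSubgroup.card_addSubgroup_dvd_card φ.range

end Abstract

/-! ## §1 The filtration `Sel_n ≤ Sel♯⁽ᵐ⁾_n ≤ A_n` and the divisibility `[Sel♯⁽ᵐ⁾_n : Sel_n] ∣ #ker g_n` (any `p`, any `κ`, no hypothesis) -/

section Preimage

variable {K : Type u} [Field K] [NumberField K] (W : WeierstrassCurve K) {p : ℕ} [hp : Fact p.Prime] (κ : ZpExtension K p)

omit [NumberField K] in
/-- Transitivity of restriction between layers: `res_{n→m′} = res_{m→m′} ∘ res_{n→m}` on `H¹(K_n, E[p^∞])`. [cite: SerreGaloisCohomology1997, I.§2.5] -/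
theorem resOfLe_layer_trans {n m m' : ℕ} (hnm : n ≤ m) (hmm' : m ≤ m') (c : W.subgroupH1 p (κ.layerSubgroup n)) :
    W.resOfLe p (κ.layerSubgroup_antitone (hnm.trans hmm')) c =
      W.resOfLe p (κ.layerSubgroup_antitone hmm') (W.resOfLe p (κ.layerSubgroup_antitone hnm) c) :=
  (congrArg (fun f ↦ f c) (W.resOfLe_comp_holds p (κ.layerSubgroup_antitone hmm') (κ.layerSubgroup_antitone hnm))).symm

omit [NumberField K] in
/-- `h_n = h_m ∘ res_{n→m}`: restriction to `K_∞` factors through every intermediate layer. [cite: SerreGaloisCohomology1997, I.§2.5] [cite: GreenbergLNM1716, §3 p. 85] -/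
theorem layerToInfty_eq_layerToInfty_resOfLe {n m : ℕ} (hnm : n ≤ m) (c : W.subgroupH1 p (κ.layerSubgroup n)) :
    W.layerToInfty κ n c = W.layerToInfty κ m (W.resOfLe p (κ.layerSubgroup_antitone hnm) c) :=
  (congrArg (fun f ↦ f c) (W.resOfLe_comp_holds p (κ.kerSubgroup_le_layerSubgroup m) (κ.layerSubgroup_antitone hnm))).symm

/-- `Sel_{p^∞}(E/K_n) ≤ Sel♯⁽ᵐ⁾_n := res⁻¹_{K_n→K_m}(Sel_{p^∞}(E/K_m))` (restriction preserves the local conditions, tree `resOfLe_mem_selmerLayer`).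
[cite: GreenbergLNM1716, §1 Thm. 1.2] -/
theorem selmerLayer_le_comap_resOfLe {n m : ℕ} (hnm : n ≤ m) :
    W.selmerLayer κ n ≤ (W.selmerLayer κ m).comap (W.resOfLe p (κ.layerSubgroup_antitone hnm)) :=
  fun _ hc ↦ AddSubgroup.mem_comap.mpr (W.resOfLe_mem_selmerLayer κ hnm hc)

/-- ★ The relaxed groups INCREASE with the relaxing layer: `Sel♯⁽ᵐ⁾_n ≤ Sel♯⁽ᵐ′⁾_n` for `n ≤ m ≤ m′` (`res_{n→m′} = res_{m→m′} ∘ res_{n→m}` and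
`res(Sel_m) ⊆ Sel_{m′}`). [cite: GreenbergLNM1716, §1 Thm. 1.2] [cite: SerreGaloisCohomology1997, I.§2.5] -/
theorem comap_resOfLe_selmerLayer_mono {n m m' : ℕ} (hnm : n ≤ m) (hmm' : m ≤ m') :
    (W.selmerLayer κ m).comap (W.resOfLe p (κ.layerSubgroup_antitone hnm)) ≤
      (W.selmerLayer κ m').comap (W.resOfLe p (κ.layerSubgroup_antitone (hnm.trans hmm'))) := by
  intro c hc
  rw [AddSubgroup.mem_comap] at hc ⊢
  rw [resOfLe_layer_trans W κ hnm hmm']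
  exact W.resOfLe_mem_selmerLayer κ hmm' hc

/-- ★★ **`Sel♯⁽ᵐ⁾_n ≤ A_n = h_n⁻¹(Sel_{p^∞}(E/K_∞))`**: a class whose restriction to `K_m` is Selmer restricts into `Sel_{p^∞}(E/K_∞)` (`h_n = h_m ∘ res_{n→m}`,
`h_m(Sel_m) ⊆ Sel_∞`). The relaxed group of gen 58 is INSIDE Greenberg's preimage. [cite: GreenbergLNM1716, §3 p. 85 (the groups `G_E(F_n)`, the map `g_n`)]
[cite: SerreGaloisCohomology1997, I.§2.5] -/
theorem comap_resOfLe_selmerLayer_le_selmerInftyPreimage {n m : ℕ} (hnm : n ≤ m) :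
    (W.selmerLayer κ m).comap (W.resOfLe p (κ.layerSubgroup_antitone hnm)) ≤ W.selmerInftyPreimage κ n := by
  intro c hc
  rw [AddSubgroup.mem_comap] at hc
  rw [mem_selmerInftyPreimage_iff, layerToInfty_eq_layerToInfty_resOfLe W κ hnm]
  exact W.map_layerToInfty_selmerLayer_le_holds κ m (AddSubgroup.mem_map_of_mem _ hc)

/-- `A_n = res⁻¹_{n→m}(A_m)`: Greenberg's preimages are compatible with restriction between layers (`h_n = h_m ∘ res_{n→m}`).
[cite: GreenbergLNM1716, §3 pp. 85–86] -/
theorem selmerInftyPreimage_eq_comap_resOfLe {n m : ℕ} (hnm : n ≤ m) :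
    W.selmerInftyPreimage κ n = (W.selmerInftyPreimage κ m).comap (W.resOfLe p (κ.layerSubgroup_antitone hnm)) := by
  ext c
  rw [AddSubgroup.mem_comap, mem_selmerInftyPreimage_iff, mem_selmerInftyPreimage_iff, layerToInfty_eq_layerToInfty_resOfLe W κ hnm]

/-- The top of the filtration: `h_n⁻¹(Sel_∞)` is the tree's `selmerInftyPreimage` (definitional; recorded for the reader). [cite: GreenbergLNM1716, §3 p. 85] -/
theorem comap_layerToInfty_selmerInfty_eq (n : ℕ) : (W.selmerInfty κ).comap (W.layerToInfty κ n) = W.selmerInftyPreimage κ n := rfl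

/-- **`#A_n = #ker g_n · #Sel_{p^∞}(E/K_n)`** (`ker g_n = A_n/Sel_n` is the tree's `KerG κ n`; Lagrange, `Nat.card`, no finiteness).
[cite: GreenbergLNM1716, §3 p. 90, §4 Lemma 4.3] -/
theorem natCard_selmerInftyPreimage_eq_mul (n : ℕ) :
    Nat.card (W.selmerInftyPreimage κ n) = Nat.card (W.KerG κ n) * Nat.card (W.selmerLayer κ n) := by
  rw [AddSubgroup.card_eq_card_quotient_mul_card_addSubgroup ((W.selmerLayer κ n).addSubgroupOf (W.selmerInftyPreimage κ n))]
  congr 1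
  exact Nat.card_congr (AddSubgroup.addSubgroupOfEquivOfLe (W.selmerLayer_le_selmerInftyPreimage κ n)).toEquiv

/-- `[A_n : Sel_n] = #ker g_n` (the tree's `KerG κ n` IS the quotient `A_n / Sel_n`; definitional). [cite: GreenbergLNM1716, §3 p. 90] -/
theorem relIndex_selmerLayer_selmerInftyPreimage (n : ℕ) :
    (W.selmerLayer κ n).relIndex (W.selmerInftyPreimage κ n) = Nat.card (W.KerG κ n) := rfl

/-- ★★★ **`[Sel♯⁽ᵐ⁾_n : Sel_n] ∣ #ker g_n`**: the index of the honest Selmer group in the `K_m`-relaxed one DIVIDES the order of Greenberg's control kernel at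
level `n` (`Sel_n ≤ Sel♯⁽ᵐ⁾_n ≤ A_n` and `[A_n : Sel_n] = [A_n : Sel♯]·[Sel♯ : Sel_n]`). No hypothesis. [cite: GreenbergLNM1716, §3 pp. 85–90] -/
theorem relIndex_selmerLayer_comap_dvd_natCard_kerG {n m : ℕ} (hnm : n ≤ m) :
    (W.selmerLayer κ n).relIndex ((W.selmerLayer κ m).comap (W.resOfLe p (κ.layerSubgroup_antitone hnm))) ∣ Nat.card (W.KerG κ n) := by
  rw [← relIndex_selmerLayer_selmerInftyPreimage W κ n]
  exact Dvd.intro _ (AddSubgroup.relIndex_mul_relIndex _ _ _ (selmerLayer_le_comap_resOfLe W κ hnm)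
    (comap_resOfLe_selmerLayer_le_selmerInftyPreimage W κ hnm))

/-- ★★ `#Sel♯⁽ᵐ⁾_n = #Sel_n · [Sel♯⁽ᵐ⁾_n : Sel_n]`. [folklore] -/
theorem natCard_comap_resOfLe_selmerLayer_eq_mul {n m : ℕ} (hnm : n ≤ m) :
    Nat.card ((W.selmerLayer κ m).comap (W.resOfLe p (κ.layerSubgroup_antitone hnm))) =
      Nat.card (W.selmerLayer κ n) * (W.selmerLayer κ n).relIndex ((W.selmerLayer κ m).comap (W.resOfLe p (κ.layerSubgroup_antitone hnm))) :=
  natCard_eq_natCard_mul_relIndex (selmerLayer_le_comap_resOfLe W κ hnm)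

/-- ★★★ **`#Sel_{p^∞}(E/K_n) ∣ #Sel♯⁽ᵐ⁾_n ∣ #Sel_{p^∞}(E/K_n) · #ker g_n`** — the `K_m`-relaxed Selmer group at level `n` exceeds the honest one by a factor dividing
Greenberg's control kernel (as `Nat.card`s; no finiteness, reduction, ordinarity or cyclotomicity hypothesis). [cite: GreenbergLNM1716, §3 pp. 85–90, §4 Lemma 4.3] -/
theorem natCard_comap_resOfLe_selmerLayer_dvd {n m : ℕ} (hnm : n ≤ m) :
    Nat.card (W.selmerLayer κ n) ∣ Nat.card ((W.selmerLayer κ m).comap (W.resOfLe p (κ.layerSubgroup_antitone hnm))) ∧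
      Nat.card ((W.selmerLayer κ m).comap (W.resOfLe p (κ.layerSubgroup_antitone hnm))) ∣ Nat.card (W.selmerLayer κ n) * Nat.card (W.KerG κ n) := by
  refine ⟨AddSubgroup.card_dvd_of_le (selmerLayer_le_comap_resOfLe W κ hnm), ?_⟩
  rw [mul_comm, ← natCard_selmerInftyPreimage_eq_mul W κ n]
  exact AddSubgroup.card_dvd_of_le (comap_resOfLe_selmerLayer_le_selmerInftyPreimage W κ hnm)

/-- ★★ **`[A_n : Sel♯⁽ᵐ⁾_n] ∣ #ker g_m`**: the quotient of Greenberg's preimage by the RELAXED group embeds into `ker g_m = A_m/Sel_m` under `res_{n→m}`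
(`A_n = res⁻¹(A_m)`, `Sel♯⁽ᵐ⁾_n = res⁻¹(Sel_m)`: the kernel of `A_n → A_m/Sel_m` is exactly `Sel♯⁽ᵐ⁾_n`). [cite: GreenbergLNM1716, §3 pp. 85–90] -/
theorem relIndex_comap_selmerInftyPreimage_dvd_natCard_kerG {n m : ℕ} (hnm : n ≤ m) :
    ((W.selmerLayer κ m).comap (W.resOfLe p (κ.layerSubgroup_antitone hnm))).relIndex (W.selmerInftyPreimage κ n) ∣ Nat.card (W.KerG κ m) := by
  have hA : ∀ y : W.selmerInftyPreimage κ n, W.resOfLe p (κ.layerSubgroup_antitone hnm) y ∈ W.selmerInftyPreimage κ m := fun y ↦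
    AddSubgroup.mem_comap.mp ((selmerInftyPreimage_eq_comap_resOfLe W κ hnm).le y.2)
  let ψ : W.selmerInftyPreimage κ n →+ W.selmerInftyPreimage κ m :=
    ((W.resOfLe p (κ.layerSubgroup_antitone hnm)).comp (W.selmerInftyPreimage κ n).subtype).codRestrict (W.selmerInftyPreimage κ m) fun y ↦ hA y
  let φ : W.selmerInftyPreimage κ n →+ W.KerG κ m := (QuotientAddGroup.mk' _).comp ψ
  have hker : φ.ker = ((W.selmerLayer κ m).comap (W.resOfLe p (κ.layerSubgroup_antitone hnm))).addSubgroupOf (W.selmerInftyPreimage κ n) := by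
    ext y
    rw [AddMonoidHom.mem_ker, AddSubgroup.mem_addSubgroupOf, AddSubgroup.mem_comap, AddMonoidHom.comp_apply, QuotientAddGroup.mk'_apply,
      QuotientAddGroup.eq_zero_iff, AddSubgroup.mem_addSubgroupOf]
    rfl
  have h := index_ker_dvd_natCard φ
  rw [hker] at h
  exact h

/-- ★★ THE TWO-SIDED FORM: **`#ker g_n = [Sel♯⁽ᵐ⁾_n : Sel_n] · [A_n : Sel♯⁽ᵐ⁾_n]`** with the second factor dividing `#ker g_m` — the layer-relaxation defect is the
part of Greenberg's `ker g_n` that dies in `ker g_m`. [cite: GreenbergLNM1716, §3 pp. 85–90] -/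
theorem natCard_kerG_eq_relIndex_mul_relIndex {n m : ℕ} (hnm : n ≤ m) :
    Nat.card (W.KerG κ n) =
      (W.selmerLayer κ n).relIndex ((W.selmerLayer κ m).comap (W.resOfLe p (κ.layerSubgroup_antitone hnm))) *
        ((W.selmerLayer κ m).comap (W.resOfLe p (κ.layerSubgroup_antitone hnm))).relIndex (W.selmerInftyPreimage κ n) := by
  rw [← relIndex_selmerLayer_selmerInftyPreimage W κ n]
  exact (AddSubgroup.relIndex_mul_relIndex _ _ _ (selmerLayer_le_comap_resOfLe W κ hnm) (comap_resOfLe_selmerLayer_le_selmerInftyPreimage W κ hnm)).symm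

/-- ★★ **`#ker g_n ∣ [Sel♯⁽ᵐ⁾_n : Sel_n] · #ker g_m`**: up to what survives to level `m`, Greenberg's kernel at level `n` IS the relaxation defect.
[cite: GreenbergLNM1716, §3 pp. 85–90] -/
theorem natCard_kerG_dvd_relIndex_mul_natCard_kerG {n m : ℕ} (hnm : n ≤ m) :
    Nat.card (W.KerG κ n) ∣
      (W.selmerLayer κ n).relIndex ((W.selmerLayer κ m).comap (W.resOfLe p (κ.layerSubgroup_antitone hnm))) * Nat.card (W.KerG κ m) := by
  rw [natCard_kerG_eq_relIndex_mul_relIndex W κ hnm]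
  exact mul_dvd_mul_left _ (relIndex_comap_selmerInftyPreimage_dvd_natCard_kerG W κ hnm)

end Preimage

/-! ## §2 The local form of the relaxed condition: the defect lives at the non-split finite places -/

section Local

variable {K : Type u} [Field K] [NumberField K] (W : WeierstrassCurve K) {p : ℕ} [hp : Fact p.Prime] (κ : ZpExtension K p)

omit [NumberField K] in
/-- `Gal(K̄_E/E·K_m) ≤ Gal(K̄_E/E·K_n)` for `n ≤ m`: the local subgroups of the layers are nested. [cite: GreenbergLNM1716, §3 p. 86] -/
theorem localSubgroup_layer_antitone (E : Type u) [Field E] [Algebra K E] {n m : ℕ} (hnm : n ≤ m) :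
    localSubgroup (κ.layerSubgroup m) E ≤ localSubgroup (κ.layerSubgroup n) E :=
  Subgroup.comap_mono (κ.layerSubgroup_antitone hnm)

omit [NumberField K] in
/-- ★ **Localisation commutes with restriction between layers**: `loc_{E,m}(res_{n→m} c) = res^{loc}_{n→m}(loc_{E,n} c)` (tree `localResOverOfEmb_resOfLe` at the chosen
embedding). [cite: GreenbergLNM1716, §3 p. 86 (the commutative diagram)] [cite: SerreGaloisCohomology1997, I.§2.4] -/
theorem localResOver_resOfLe_layer (E : Type u) [Field E] [Algebra K E] {n m : ℕ} (hnm : n ≤ m) (c : W.subgroupH1 p (κ.layerSubgroup n)) :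
    W.localResOver p (κ.layerSubgroup m) E (W.resOfLe p (κ.layerSubgroup_antitone hnm) c) =
      Literature.NumberTheory.EllipticCurves.resOfLe (localPoints W E) (localSubgroup_layer_antitone κ E hnm) (W.localResOver p (κ.layerSubgroup n) E c) :=
  W.localResOverOfEmb_resOfLe p (closureEmb (K := K) E) (κ.layerSubgroup_antitone hnm) c

/-- ★★ **THE LOCAL FORM OF THE RELAXED CONDITION.** `c ∈ Sel♯⁽ᵐ⁾_n = res⁻¹_{n→m}(Sel_{p^∞}(E/K_m))` iff for every place `v` of `K` (finite or infinite) and every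
`σ ∈ Γ_K` the localisation of `conj_σ c` lies in the LOCAL inflation–restriction kernel `ker(H¹(Gal(K̄_v/K_vK_n), E(K̄_v)) → H¹(Gal(K̄_v/K_vK_m), E(K̄_v)))` — the
honest condition «`= 0`» RELAXED to «dies over `K_vK_m`». [cite: GreenbergLNM1716, §2, §3 p. 86] [cite: SerreGaloisCohomology1997, I.§2.6 (b)] [cite: Kramer1981, eq. (11)] -/
theorem mem_comap_resOfLe_selmerLayer_iff {n m : ℕ} (hnm : n ≤ m) (c : W.subgroupH1 p (κ.layerSubgroup n)) :
    c ∈ (W.selmerLayer κ m).comap (W.resOfLe p (κ.layerSubgroup_antitone hnm)) ↔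
      (∀ (v : HeightOneSpectrum (𝓞 K)) (σ : Field.absoluteGaloisGroup K),
          W.localResOver p (κ.layerSubgroup n) (v.adicCompletion K) (W.conjH1 p (κ.layerSubgroup n) σ c) ∈
            (Literature.NumberTheory.EllipticCurves.resOfLe (localPoints W (v.adicCompletion K))
              (localSubgroup_layer_antitone κ (v.adicCompletion K) hnm)).ker) ∧
        ∀ (w : InfinitePlace K) (σ : Field.absoluteGaloisGroup K),
          W.localResOver p (κ.layerSubgroup n) w.Completion (W.conjH1 p (κ.layerSubgroup n) σ c) ∈
            (Literature.NumberTheory.EllipticCurves.resOfLe (localPoints W w.Completion)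
              (localSubgroup_layer_antitone κ w.Completion hnm)).ker := by
  rw [AddSubgroup.mem_comap]
  change W.resOfLe p _ c ∈ W.selmerGroupOver p (κ.layerSubgroup m) ↔ _
  rw [W.mem_selmerGroupOver_iff p]
  have hcomm : ∀ σ, W.conjH1 p (κ.layerSubgroup m) σ (W.resOfLe p (κ.layerSubgroup_antitone hnm) c) =
      W.resOfLe p (κ.layerSubgroup_antitone hnm) (W.conjH1 p (κ.layerSubgroup n) σ c) :=
    fun σ ↦ (congrArg (fun f ↦ f c) (resOfLe_comp_conjH1_holds (M := geomPrimaryTorsion W p) (κ.layerSubgroup_antitone hnm) σ)).symm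
  simp only [hcomm, mem_localKerOver_iff, localResOver_resOfLe_layer W κ _ hnm, AddMonoidHom.mem_ker]

omit [NumberField K] in
/-- ★ **The finite-step local kernel sits inside Greenberg's local tower kernel**: `ker(res : H¹(K_vK_n) → H¹(K_vK_m)) ≤ 𝒦_{v,n} = ker(res : H¹(K_vK_n) → H¹(K_vK_∞))`
(`res_{n→∞} = res_{m→∞} ∘ res_{n→m}` locally). [cite: GreenbergLNM1716, §3 p. 86 (`r_{v_n}`)] [cite: SerreGaloisCohomology1997, I.§2.5] -/
theorem ker_resOfLe_local_le_localTowerKer (E : Type u) [Field E] [Algebra K E] {n m : ℕ} (hnm : n ≤ m) :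
    (Literature.NumberTheory.EllipticCurves.resOfLe (localPoints W E) (localSubgroup_layer_antitone κ E hnm)).ker ≤ W.localTowerKer κ E n := by
  intro x hx
  rw [AddMonoidHom.mem_ker] at hx
  rw [mem_localTowerKer_iff]
  have e := congrArg (fun f ↦ f x)
    (Literature.NumberTheory.EllipticCurves.resOfLe_comp_holds (M := localPoints W E) (localSubgroup_ker_le_layer κ E m) (localSubgroup_layer_antitone κ E hnm))
  simp only [AddMonoidHom.coe_comp, Function.comp_apply, hx, map_zero] at e
  exact e.symm

/-- For `c ∈ Sel♯⁽ᵐ⁾_n` every localisation `loc_v(conj_σ c)` lies in Greenberg's local tower kernel `𝒦_{v,n}` (also a consequence of `Sel♯ ≤ A_n`).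
[cite: GreenbergLNM1716, §3 pp. 85–86] -/
theorem localResOver_conjH1_mem_localTowerKer_of_mem_comap {n m : ℕ} (hnm : n ≤ m) {c : W.subgroupH1 p (κ.layerSubgroup n)}
    (hc : c ∈ (W.selmerLayer κ m).comap (W.resOfLe p (κ.layerSubgroup_antitone hnm))) (v : HeightOneSpectrum (𝓞 K)) (σ : Field.absoluteGaloisGroup K) :
    W.localResOver p (κ.layerSubgroup n) (v.adicCompletion K) (W.conjH1 p (κ.layerSubgroup n) σ c) ∈ W.localTowerKer κ (v.adicCompletion K) n :=
  W.localResOver_conjH1_mem_localTowerKer_of_mem κ (comap_resOfLe_selmerLayer_le_selmerInftyPreimage W κ hnm hc) v σ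

omit [NumberField K] in
/-- ★ **At the archimedean places the finite-step local kernel VANISHES**: every archimedean place splits completely in `K_∞/K` (tree
`ZpExtension.resGal_infinitePlace_mem_kerSubgroup`), so `Gal(K̄_w/K_wK_n) = Gal(K̄_w/K_wK_m) = Γ_{K_w}` and restriction along equal subgroups is injective.
[cite: GreenbergLNM1716, §3 p. 86] -/
theorem ker_resOfLe_local_infinitePlace_eq_bot (w : InfinitePlace K) {n m : ℕ} (hnm : n ≤ m) :
    (Literature.NumberTheory.EllipticCurves.resOfLe (localPoints W w.Completion) (localSubgroup_layer_antitone κ w.Completion hnm)).ker = ⊥ := by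
  rw [AddMonoidHom.ker_eq_bot_iff]
  have hle : localSubgroup (κ.layerSubgroup n) w.Completion ≤ localSubgroup (κ.layerSubgroup m) w.Completion := fun τ _ ↦
    (mem_localSubgroup_iff (κ.layerSubgroup m) w.Completion τ).mpr (κ.kerSubgroup_le_layerSubgroup m (κ.resGal_infinitePlace_mem_kerSubgroup w τ))
  exact resOfLe_injective_of_ge (localPoints W w.Completion) (localSubgroup_layer_antitone κ w.Completion hnm) hle

/-- ★★ **The relaxed group satisfies the HONEST archimedean conditions** (any `p`, any `ℤ_p`-extension: no relaxation at infinity).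
[cite: GreenbergLNM1716, §3 p. 86] -/
theorem conjH1_mem_localKerOver_infinitePlace_of_mem_comap {n m : ℕ} (hnm : n ≤ m) {c : W.subgroupH1 p (κ.layerSubgroup n)}
    (hc : c ∈ (W.selmerLayer κ m).comap (W.resOfLe p (κ.layerSubgroup_antitone hnm))) (w : InfinitePlace K) (σ : Field.absoluteGaloisGroup K) :
    W.conjH1 p (κ.layerSubgroup n) σ c ∈ W.localKerOver p (κ.layerSubgroup n) w.Completion := by
  have h := ((mem_comap_resOfLe_selmerLayer_iff W κ hnm c).mp hc).2 w σ
  rw [ker_resOfLe_local_infinitePlace_eq_bot W κ w hnm, AddSubgroup.mem_bot] at h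
  rw [mem_localKerOver_iff]
  exact h

/-- ★★ **At a finite place whose chosen place of `K_n` SPLITS COMPLETELY in `K_m` (`Gal(K̄_v/K_vK_n) ≤ Gal(K̄_v/K_vK_m)`, i.e. equality) the relaxed condition
IS the honest one**: a relaxed class satisfies the honest local condition at `(v, σ)` for every `σ`. [cite: GreenbergLNM1716, §3 p. 86] [cite: Kramer1981, §2 (i_v = 0 at split places)] -/
theorem conjH1_mem_localKerOver_of_mem_comap_of_le {n m : ℕ} (hnm : n ≤ m) {c : W.subgroupH1 p (κ.layerSubgroup n)}
    (hc : c ∈ (W.selmerLayer κ m).comap (W.resOfLe p (κ.layerSubgroup_antitone hnm))) (v : HeightOneSpectrum (𝓞 K))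
    (hsplit : localSubgroup (κ.layerSubgroup n) (v.adicCompletion K) ≤ localSubgroup (κ.layerSubgroup m) (v.adicCompletion K))
    (σ : Field.absoluteGaloisGroup K) :
    W.conjH1 p (κ.layerSubgroup n) σ c ∈ W.localKerOver p (κ.layerSubgroup n) (v.adicCompletion K) := by
  have h := ((mem_comap_resOfLe_selmerLayer_iff W κ hnm c).mp hc).1 v σ
  rw [AddMonoidHom.mem_ker] at h
  rw [mem_localKerOver_iff]
  exact resOfLe_injective_of_ge (localPoints W (v.adicCompletion K)) _ hsplit (by rw [h, map_zero])

/-- ★★★ **THE DEFECT LIVES AT THE NON-SPLIT FINITE PLACES.** A `K_m`-relaxed Selmer class over `K_n` that satisfies the HONEST local conditions at the finite places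
`v` of `K` whose place of `K_n` does not split completely in `K_m` is an honest Selmer class: `c ∈ Sel♯⁽ᵐ⁾_n`, and for every finite `v` EITHER
`Gal(K̄_v/K_vK_n) = Gal(K̄_v/K_vK_m)` OR `conj_σ c` satisfies the local condition at `v` for all `σ`, imply `c ∈ Sel_{p^∞}(E/K_n)`. (In a `ℤ_p`-tower the
non-split places of `K_m/K_n` are finitely many: those above `p` and the ramified ones — not used here.) [cite: GreenbergLNM1716, §3 pp. 86–90]
[cite: Kramer1981, Prop. 7 and eq. (11)] -/
theorem mem_selmerLayer_of_mem_comap {n m : ℕ} (hnm : n ≤ m) {c : W.subgroupH1 p (κ.layerSubgroup n)}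
    (hc : c ∈ (W.selmerLayer κ m).comap (W.resOfLe p (κ.layerSubgroup_antitone hnm)))
    (h : ∀ v : HeightOneSpectrum (𝓞 K),
      localSubgroup (κ.layerSubgroup n) (v.adicCompletion K) ≤ localSubgroup (κ.layerSubgroup m) (v.adicCompletion K) ∨
        ∀ σ : Field.absoluteGaloisGroup K, W.conjH1 p (κ.layerSubgroup n) σ c ∈ W.localKerOver p (κ.layerSubgroup n) (v.adicCompletion K)) :
    c ∈ W.selmerLayer κ n := by
  change c ∈ W.selmerGroupOver p (κ.layerSubgroup n)
  rw [W.mem_selmerGroupOver_iff p]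
  refine ⟨fun v σ ↦ ?_, fun w σ ↦ conjH1_mem_localKerOver_infinitePlace_of_mem_comap W κ hnm hc w σ⟩
  rcases h v with hsplit | hhonest
  · exact conjH1_mem_localKerOver_of_mem_comap_of_le W κ hnm hc v hsplit σ
  · exact hhonest σ

/-- ★★ Equality form: **`Sel♯⁽ᵐ⁾_n = Sel_{p^∞}(E/K_n)` whenever every finite place splits completely from `K_n` to `K_m` at the chosen embedding OR carries no relaxed
class outside the honest condition** — in particular the relaxation is invisible away from the non-split places. [cite: GreenbergLNM1716, §3 pp. 86–90] -/
theorem comap_resOfLe_selmerLayer_eq_of_forall {n m : ℕ} (hnm : n ≤ m)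
    (h : ∀ v : HeightOneSpectrum (𝓞 K),
      localSubgroup (κ.layerSubgroup n) (v.adicCompletion K) ≤ localSubgroup (κ.layerSubgroup m) (v.adicCompletion K) ∨
        ∀ c ∈ (W.selmerLayer κ m).comap (W.resOfLe p (κ.layerSubgroup_antitone hnm)), ∀ σ : Field.absoluteGaloisGroup K,
          W.conjH1 p (κ.layerSubgroup n) σ c ∈ W.localKerOver p (κ.layerSubgroup n) (v.adicCompletion K)) :
    (W.selmerLayer κ m).comap (W.resOfLe p (κ.layerSubgroup_antitone hnm)) = W.selmerLayer κ n := by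
  refine le_antisymm (fun c hc ↦ mem_selmerLayer_of_mem_comap W κ hnm hc fun v ↦ ?_) (selmerLayer_le_comap_resOfLe W κ hnm)
  rcases h v with hsplit | hhonest
  · exact Or.inl hsplit
  · exact Or.inr (hhonest c hc)

end Local

end Summit.BirchSwinnertonDyer.BirchSwinnertonDyer.Theorems.AlignedTransportAtTwoHalfDescentLayerIndexGrowthFiniteTwistRelaxed

end
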